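import Literature.AnabelianGeometry.EtaleTheta.ThetaSettingHatThetaOfCurve
import Literature.AnabelianGeometry.EtaleTheta.SettingModelChiCuspCyclotomes
import Literature.AnabelianGeometry.EtaleTheta.SettingModelTateCyclotomes
import Literature.AnabelianGeometry.EtaleTheta.SettingModelTateCuspCyclotomes
import HarnessLib

/-!
# [EtTh] §1 p. 12 / Rmk. 1.6.4: the profinite theta quotient record `ThetaSetting.HatTheta` INHABITED OUTRIGHT at the
# cusped χ-model `modelχ′` and at the TATE DATA OF RECORD `modelχq p i j` / `modelχq′ p i j` (even `j`) — no binder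

S. Mochizuki, *The Étale Theta Function …* [EtTh], Publ. RIMS **45** (2009), §1, PDF p. 12 (PRIMS p. 238):
"`Π_X = (Π^tp_X)^∧`", "`Δ^Θ_X = Δ_X/[Δ_X,[Δ_X,Δ_X]]`", "`(Ẑ(1) ≅) Δ_Θ`" [cite: MochizukiEtTh2009, §1 p.12]; Rmk. 1.6.4,
PDF p. 26 (PRIMS p. 252) [cite: MochizukiEtTh2009, Rmk 1.6.4 p.26].

Layer L2 of the abc-iut cell, seat abc-iut-f-142 gen 8, row «HATTHETA-OF-CURVE» (abc-iut-L2-lead gen 8 R1273), file D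
(rider to file C `ThetaSettingHatThetaModelChi.lean`, which does `modelχ`): the remaining curve-based models of record
all have `GtpTheta := CurveTheta.GTheta _` BY DEFINITION and a landed THEOREM «`Δ_Θ` compact» — abc-iut-L2's
`SettingModel.isCompact_deltaTheta_modelχ'` (`SettingModelChiCuspCyclotomes`), `isCompact_deltaTheta_modelχq`
(`SettingModelTateCyclotomes`, from the stage-2 coordinates `deltaThetaCoordχq : Ẑ ↠ Δ_Θ`), `isCompact_deltaTheta_modelχq'`
(`SettingModelTateCuspCyclotomes`) — so abc-iut-f-142's constructor `HatTheta.ofCurveTheta` (p506865) with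
`e := ContinuousMulEquiv.refl`, `he := rfl` inhabits the record at each of them with NO hypothesis; in particular at the
Tate datum of record `modelχq p 1 2` over which the cell's [EtTh] §1–§2 tokens are stated.

HONEST LABEL: SEMI-SYNTHETIC models (consistency evidence for OUR typed interfaces, not tempered fundamental groups of
curves); inhabited-at-a-model ≠ proved in print; nothing of [EtTh] Rmk. 1.6.4 is asserted; no side is taken on
[IUTchIII] Cor. 3.12; nothing here asserts that abc is proved or refuted.  Class (b) (three `def`s = the instances),
no `instance` keyword, no notation, no `Prop`-fact.
-/

noncomputable section

namespace Literature.AnabelianGeometry.EtaleTheta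

open Literature.AnabelianGeometry.SemiGraphs SettingModel

variable (p : ℕ) [Fact p.Prime] (i j : ℤ) (hj : Even j)

namespace ThetaSetting

/-- **The profinite theta quotient record at the cusped χ-model `modelχ′`, NO binder** (`Δ_Θ` compact by
`SettingModel.isCompact_deltaTheta_modelχ'`). [cite: MochizukiEtTh2009, §1 p.12] -/
def hatThetaModelχ' : (ThetaSetting.modelχ' p).HatTheta :=
  HatTheta.ofCurveTheta (ThetaSetting.modelχ' p) (ContinuousMulEquiv.refl _) (fun _ => rfl)
    (isCompact_deltaTheta_modelχ' p)

/-- `Nonempty (modelχ′ p).HatTheta`. [cite: MochizukiEtTh2009, Rmk 1.6.4 p.26] -/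
theorem nonempty_hatTheta_modelχ' : Nonempty (ThetaSetting.modelχ' p).HatTheta := ⟨hatThetaModelχ' p⟩

/-- **The profinite theta quotient record at the TATE DATUM OF RECORD `modelχq p i j` (even `j`), NO binder** (`Δ_Θ`
compact by `SettingModel.isCompact_deltaTheta_modelχq`, the image of `Ẑ` under the stage-2 coordinates).
[cite: MochizukiEtTh2009, §1 p.12] -/
def hatThetaModelχq : (ThetaSetting.modelχq p i j hj).HatTheta :=
  HatTheta.ofCurveTheta (ThetaSetting.modelχq p i j hj) (ContinuousMulEquiv.refl _) (fun _ => rfl)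
    (isCompact_deltaTheta_modelχq p i j hj)

/-- Its profinite theta quotient is `Π_X ⧸ [[Δ_X,Δ_X],Δ_X]⁻` over `curveχq p i j` (by `rfl`). [cite: MochizukiEtTh2009, §1 p.12] -/
theorem hatThetaModelχq_ghatTheta :
    (hatThetaModelχq p i j hj).GhatTheta = CurveTheta.GThetaHat (SettingModel.curveχq p i j) := rfl

/-- Its `ι` is `CurveTheta.ιTheta (curveχq p i j)` (pointwise, by `rfl`). [cite: MochizukiEtTh2009, §1 p.12] -/
theorem hatThetaModelχq_ι_apply (x : (ThetaSetting.modelχq p i j hj).GtpTheta) :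
    (hatThetaModelχq p i j hj).ι x = CurveTheta.ιTheta (SettingModel.curveχq p i j) x := rfl

/-- `Nonempty (modelχq p i j hj).HatTheta` — the record is inhabited at the Tate datum of record.
[cite: MochizukiEtTh2009, Rmk 1.6.4 p.26] -/
theorem nonempty_hatTheta_modelχq : Nonempty (ThetaSetting.modelχq p i j hj).HatTheta := ⟨hatThetaModelχq p i j hj⟩

/-- **The profinite theta quotient record at the cusped Tate datum `modelχq′ p i j` (even `j`), NO binder** (`Δ_Θ` compact
by `SettingModel.isCompact_deltaTheta_modelχq'`). [cite: MochizukiEtTh2009, §1 p.12] -/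
def hatThetaModelχq' : (ThetaSetting.modelχq' p i j hj).HatTheta :=
  HatTheta.ofCurveTheta (ThetaSetting.modelχq' p i j hj) (ContinuousMulEquiv.refl _) (fun _ => rfl)
    (isCompact_deltaTheta_modelχq' p i j hj)

/-- `Nonempty (modelχq′ p i j hj).HatTheta`. [cite: MochizukiEtTh2009, Rmk 1.6.4 p.26] -/
theorem nonempty_hatTheta_modelχq' : Nonempty (ThetaSetting.modelχq' p i j hj).HatTheta :=
  ⟨hatThetaModelχq' p i j hj⟩

end ThetaSetting

end Literature.AnabelianGeometry.EtaleTheta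

end
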